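/-
Copyright: the b2b-balaban T⁴-continuum CRUX team, row NE7b owner lineage `t4-ne7b-p1` (gen 113). Project licence.
-/
import Summits.QuantumFields.BalabanUV.Beta.D1BFx.PointColumnDecay
import Summits.QuantumFields.BalabanUV.Beta.D1BFx.PointColumnSplit

/-!
# THE BLOCK-AVERAGED MASSIVE PROPAGATOR IS BOUNDED ON `ℓ^∞` UNIFORMLY IN THE MESH: for `G′ = (Δ^η + aQ′*Q′)⁻¹` on `ℤ^d`
# (`B5Hk103ScalarZd.Gk`, the B4-Sect.5 whole-lattice kernel), `d ≥ 3`, EVERY side `n + 1`, every `a > 0`: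
# `Σ_{q∈B(y)} |G′(p,q)| ≤ A(d,a)·e^{−(δ_u∕4)|blk p − y|_∞}` for EVERY block, hence `Σ′_q |G′(p,q)| ≤ A(d,a)·K_d(δ_u∕4)` —
# the sup-currency letter of [B5] (1.115)'s KIND for the scalar `ℤ^d` object, BY PROOF, from the β-team's point-column near field
# (`PointColumnSplit`: `G′ = η²G₀ + O(η^d)`) and far field (`PointColumnDecay`: `|G′(x,q)| ≤ cFar·k²·η^d·e^{−4δ_u k}` at block
# separation `≥ 8k`) (row NE7b, node U5c; the `G`-half of the sup-currency chart letters, companion of (46); [folklore] bookkeeping)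

Cell `pub-balaban`, sub-cell `t4`, spine estimate NE7b (`T4WeightBudget.RelWeightBound`; the cell's OWN estimate — NOT PRINTED
in [Bałaban 1983–89], NOT PROVED).  Crux-route work under `Spine/NE7b/` by the row OWNER (`t4-ne7b-p1` gen 113) under FREEZE
(0)'s crux-prover clause (RULING W-ne7bp1-g113-1, FILING-CLAIM C-ne7bp1-g113-4); NOTHING of Bałaban's is asserted; no
`T4Continuum/Support` leaf typed; no `def`; zero `sorry`.  Imports (BY NAME, nothing restated): the β-flow team's D1-road files
`Beta/D1BFx/PointColumnSplit` (`abs_Gk_sub_free_le`: `|G′(p,q) − G₀(p−q)∕(n+1)²| ≤ cSplit(d,a)∕(n+1)^d` EVERYWHERE; `abs_G₀_le`,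
`sum_block_inv_nrm_pow_le`) and `Beta/D1BFx/PointColumnDecay` (`abs_Gk_far_le`), `RProjectorRange.Gk_symm`, the Literature columns
`B5Hk103ScalarZd` (`Gk`, `tsum_Gk_row`, `summable_Gk_row`, `tsum_blocks`), `Beta/PoissonInterior` (`G₀`, `nrm`).

WHY (located).  In the sup currency HRS consumes, the hard-step cell's two displayed chart letters (`T`, `‖T⁻¹ y‖ ≤ N‖y‖`, leaf-04's
HSCR — valid on ANY complete space) need, for the Gaussian skeleton, the `ℓ^∞ → ℓ^∞` constants of the TWO columns of the inverse
augmented Hessian: the section `H` ((46)(48): `C_∞(d,a)`, uniform in the side) and the block-averaged massive propagator `G′` through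
which every fluctuation covariance of the step is expressed ([B5] (1.103): `H = G′Q′*(Q′G′Q′*)⁻¹`; the fluctuation propagator is
`G′ − G′Q′*(Q′G′Q′*)⁻¹Q′G′`).  The tree's only row bound for `G′` (`D1BFx/PeriodisedKernels.rowBound_Gk`: `(2∕min(2,a))·K_4(δ_u∕(m+1))`)
GROWS like the block volume; print's (1.115) is `O(1)`.  The β-team's point-column estimates make the `O(1)` a theorem: near the pole
`G′` is `η²×`(Newton potential) up to `O(η^d)` — and `η² Σ_{block} nrm^{2−d} = O(1)` — while a block at separation `≍ 8k` carries
`(n+1)^d` sites of size `k²η^d e^{−4δ_u k}`.  This file is that bookkeeping.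

WHAT IS PROVED ([folklore]; `d ≥ 3`, `n : ℕ`, `a > 0`; `δ_u = deltaU d a`; the constant
`A(d,a) := (cG0 d·cKL d (d−2) + cSplit d a)·e^{2δ_u} + cFar d a·e^{4δ_u}∕δ_u²` is written out, no `def`):
* §1 `sum_block_abs_G₀_le` (`Σ_{q∈B(y)} |G₀(p − q)| ≤ cG0·cKL·(n+1)²`), **`sum_block_abs_Gk_le_unif`** (EVERY block:
  `Σ_{q∈B(y)} |G′(p,q)| ≤ cG0·cKL + cSplit` — the near-field letter, no decay).
* §2 `sq_le_exp` (`x² ≤ (4∕δ²)e^{δx}`), `floor_sq_exp_le` (the `k = ⌊D∕8⌋` arithmetic), **`sum_block_abs_Gk_le_far`** (`8 ≤ |blk p − y|`: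
  `Σ_{q∈B(y)} |G′(p,q)| ≤ cFar·e^{4δ_u}∕δ_u²·e^{−(δ_u∕4)|blk p − y|}`).
* §3 **`sum_block_abs_Gk_le`** (EVERY block: `≤ A(d,a)·e^{−(δ_u∕4)|blk p − y|_∞}`), **`tsum_abs_Gk_le_sup`** (`Σ′_q |G′(p,q)| ≤ A(d,a)·K_d(δ_u∕4)`
  — **`‖G′‖_{ℓ^∞→ℓ^∞} ≤ A·K_d` UNIFORMLY IN THE MESH**), `inv_a_le_supConstG` (the floor `a⁻¹ ≤ A·K_d`, from `G′·1 = a⁻¹`).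
* §4 `summable_Gk_mul_of_bounded`, **`abs_tsum_Gk_mul_le_sup`** (`|Σ′_q G′(p,q)f(q)| ≤ A·K_d(δ_u∕4)·R` for `|f| ≤ R`).
* §5 toy.

HONEST (what this is NOT).  Constants EXISTENTIAL in `d` (through `PoissonInterior`'s `C(d)` inside `cG0`, `cSplit`, `cFar`) and useless
by value; scalar (`U = 1`) `ℤ^d` object, no torus (the β-team's `periodise₂` road, `D1BFx/PeriodisedKernels`, is where a torus row bound
would be read — not here); the gradient row (`abs_Gk_diff_far_le` ∕ `abs_Gk_diff_sub_free_le` exist) is not summed here; nothing of the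
covariant propagators with the axial gauge ((A3), NC-NE7b-α UNRULED).  BY-NAME EFFECT ON THE WALL: NONE.  NE7b NOT PRINTED ∕ NOT PROVED;
spine PROVED 0∕9; rung (B)+1 on a FINITE torus — NOT infinite volume, NOT the mass gap, NOT Clay.  HONEST DEPENDENCY: continuum YM on T⁴
⇐ BetaPertH ∧ nine spine estimates (0∕9 proved); BetaPertH ⇐ (D1) ∧ (D4) ∧ CAP+tail; G-an2-4 gates asym, D1 and NE2∕3∕4.
-/

set_option autoImplicit false

namespace Summit.QuantumFields.BalabanUV.T4Continuum.NE7b.BlockPropagatorSupNorm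

open Finset Real
open Literature.MathematicalPhysics.QuantumFieldTheory.Balaban1983to89
open B4Sect5Proof (latticeConst latticeConst_nonneg)
open B6QGQLower276 (X blk B mem_B sum_B_const)
open B6QGQDecay237 (deltaU deltaU_pos)
open B5Hk103ScalarZd (Gk summable_expX tsum_expX_le summable_Gk_row tsum_Gk_row tsum_blocks summable_blocks)
open Beta.PoissonInterior (nrm one_le_nrm nrm_pos nrm_neg G₀)
open Summit.QuantumFields.BalabanUV.Beta.D1BFx.PointColumnSplit (cKL one_le_cKL sum_block_inv_nrm_pow_le cG0 cG0_nonneg abs_G₀_le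
  cSplit cSplit_nonneg abs_Gk_sub_free_le)
open Summit.QuantumFields.BalabanUV.Beta.D1BFx.PointColumnDecay (cFar cFar_pos abs_Gk_far_le)
open Summit.QuantumFields.BalabanUV.Beta.D1BFx.RProjectorRange (Gk_symm)

noncomputable section

variable {d : ℕ}

/-! ## §1. The near-field letter: every block carries `O(1)` mass -/

/-- `Σ_{q∈B(y)} |G₀(p − q)| ≤ cG0(d)·cKL(d,d−2)·(n+1)²` for every block `B(y)` and every `p` (`d ≥ 3`): the Newton envelope
`|G₀ v| ≤ cG0∕nrm v^{d−2}` summed over a block (`PointColumnSplit.sum_block_inv_nrm_pow_le`). [folklore] -/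
theorem sum_block_abs_G₀_le (hd : 3 ≤ d) (n : ℕ) (p y : X d) :
    ∑ q ∈ B n y, |G₀ (p - q)| ≤ cG0 d * cKL d (d - 2) * ((n : ℝ) + 1) ^ 2 := by
  have hd0 : 0 < d := by omega
  calc ∑ q ∈ B n y, |G₀ (p - q)| ≤ ∑ q ∈ B n y, cG0 d * (1 / nrm (q - p) ^ (d - 2)) :=
        Finset.sum_le_sum fun q _ => by
          have h := abs_G₀_le hd (p - q)
          rw [← nrm_neg, neg_sub] at h
          exact h.trans (le_of_eq (by ring))
    _ = cG0 d * ∑ q ∈ B n y, 1 / nrm (q - p) ^ (d - 2) := by rw [Finset.mul_sum]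
    _ ≤ cG0 d * (cKL d (d - 2) * ((n : ℝ) + 1) ^ (d - (d - 2))) :=
        mul_le_mul_of_nonneg_left (sum_block_inv_nrm_pow_le hd0 (by omega) n y p) (cG0_nonneg d)
    _ = cG0 d * cKL d (d - 2) * ((n : ℝ) + 1) ^ 2 := by rw [show d - (d - 2) = 2 by omega]; ring

/-- **THE NEAR-FIELD LETTER** (`d ≥ 3`): for EVERY block `B(y)`, `Σ_{q∈B(y)} |G′(p,q)| ≤ cG0·cKL(d,d−2) + cSplit(d,a)` — `G′ = η²G₀(p−·) + O(η^d)`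
entrywise (`abs_Gk_sub_free_le`), `η²·Σ_{block}|G₀| ≤ cG0·cKL` and `(n+1)^d` entries of size `cSplit·η^d`. [folklore] -/
theorem sum_block_abs_Gk_le_unif (hd : 3 ≤ d) (n : ℕ) {a : ℝ} (ha : 0 < a) (p y : X d) :
    ∑ q ∈ B n y, |Gk n a p q| ≤ cG0 d * cKL d (d - 2) + cSplit d a := by
  have hs : (0 : ℝ) < (n : ℝ) + 1 := by positivity
  have hsd : (0 : ℝ) < ((n : ℝ) + 1) ^ d := pow_pos hs d
  have hpt : ∀ q : X d, |Gk n a p q| ≤ |G₀ (p - q)| / ((n : ℝ) + 1) ^ 2 + cSplit d a / ((n : ℝ) + 1) ^ d := by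
    intro q
    have h := abs_Gk_sub_free_le hd n ha p q
    have htri := abs_sub_abs_le_abs_sub (Gk n a p q) (G₀ (p - q) / ((n : ℝ) + 1) ^ 2)
    rw [abs_div, abs_of_pos (pow_pos hs 2)] at htri
    linarith
  calc ∑ q ∈ B n y, |Gk n a p q|
      ≤ ∑ q ∈ B n y, (|G₀ (p - q)| / ((n : ℝ) + 1) ^ 2 + cSplit d a / ((n : ℝ) + 1) ^ d) := Finset.sum_le_sum fun q _ => hpt q
    _ = (∑ q ∈ B n y, |G₀ (p - q)|) / ((n : ℝ) + 1) ^ 2 + ((n : ℝ) + 1) ^ d * (cSplit d a / ((n : ℝ) + 1) ^ d) := by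
        rw [Finset.sum_add_distrib, Finset.sum_div, sum_B_const]
    _ ≤ (cG0 d * cKL d (d - 2) * ((n : ℝ) + 1) ^ 2) / ((n : ℝ) + 1) ^ 2 + ((n : ℝ) + 1) ^ d * (cSplit d a / ((n : ℝ) + 1) ^ d) := by
        gcongr
        exact sum_block_abs_G₀_le hd n p y
    _ = cG0 d * cKL d (d - 2) + cSplit d a := by field_simp

/-! ## §2. The far-field letter: a block at separation `D ≥ 8` carries `cFar·e^{4δ_u}∕δ_u²·e^{−(δ_u∕4)D}` -/

/-- `x² ≤ (4∕δ²)·e^{δx}` for `x ≥ 0`, `δ > 0` (from `1 + t ≤ e^t`). [folklore] -/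
theorem sq_le_exp {δ x : ℝ} (hδ : 0 < δ) (hx : 0 ≤ x) : x ^ 2 ≤ 4 / δ ^ 2 * Real.exp (δ * x) := by
  have h1 : δ * x / 2 + 1 ≤ Real.exp (δ * x / 2) := Real.add_one_le_exp _
  have h2 : δ * x / 2 ≤ Real.exp (δ * x / 2) := by linarith
  have h3 : 0 ≤ δ * x / 2 := by positivity
  have h4 : (δ * x / 2) ^ 2 ≤ Real.exp (δ * x / 2) ^ 2 := pow_le_pow_left₀ h3 h2 2
  rw [← Real.exp_nat_mul] at h4
  have h5 : ((2 : ℕ) : ℝ) * (δ * x / 2) = δ * x := by push_cast; ring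
  rw [h5] at h4
  have hδ2 : 0 < δ ^ 2 := pow_pos hδ 2
  rw [div_mul_eq_mul_div, le_div_iff₀ hδ2]
  nlinarith

/-- The `k = ⌊D∕8⌋` arithmetic: for `8 ≤ D` and `k := ⌊D∕8⌋₊`, `1 ≤ k`, `8k ≤ D` and `k²·e^{−4δk} ≤ e^{4δ}∕δ²·e^{−(δ∕4)D}` (`δ > 0`). [folklore] -/
theorem floor_sq_exp_le {δ D : ℝ} (hδ : 0 < δ) (hD : 8 ≤ D) :
    1 ≤ ⌊D / 8⌋₊ ∧ 8 * (⌊D / 8⌋₊ : ℝ) ≤ D ∧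
      (⌊D / 8⌋₊ : ℝ) ^ 2 * Real.exp (-(4 * δ * ⌊D / 8⌋₊)) ≤ Real.exp (4 * δ) / δ ^ 2 * Real.exp (-(δ / 4 * D)) := by
  have hD0 : 0 ≤ D := by linarith
  have hD8 : 0 ≤ D / 8 := by positivity
  have hk1 : 1 ≤ ⌊D / 8⌋₊ := Nat.one_le_floor_iff _ |>.2 (by linarith)
  have hkle : (⌊D / 8⌋₊ : ℝ) ≤ D / 8 := Nat.floor_le hD8
  have hklt : D / 8 < (⌊D / 8⌋₊ : ℝ) + 1 := Nat.lt_floor_add_one _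
  refine ⟨hk1, by linarith, ?_⟩
  have hk0 : (0 : ℝ) ≤ (⌊D / 8⌋₊ : ℝ) := Nat.cast_nonneg _
  -- `k² ≤ D²/64 ≤ (1/δ²) e^{δD/4}` and `e^{−4δk} ≤ e^{4δ} e^{−δD/2}`
  have hsq : (⌊D / 8⌋₊ : ℝ) ^ 2 ≤ (D / 8) ^ 2 := pow_le_pow_left₀ hk0 hkle 2
  have hD2 : D ^ 2 ≤ 4 / (δ / 4) ^ 2 * Real.exp (δ / 4 * D) := sq_le_exp (by positivity) hD0
  have hexp : Real.exp (-(4 * δ * ⌊D / 8⌋₊)) ≤ Real.exp (4 * δ) * Real.exp (-(δ / 2 * D)) := by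
    rw [← Real.exp_add]; exact Real.exp_le_exp.2 (by nlinarith)
  have hδ2 : 0 < δ ^ 2 := pow_pos hδ 2
  calc (⌊D / 8⌋₊ : ℝ) ^ 2 * Real.exp (-(4 * δ * ⌊D / 8⌋₊))
      ≤ (D / 8) ^ 2 * (Real.exp (4 * δ) * Real.exp (-(δ / 2 * D))) :=
        mul_le_mul hsq hexp (Real.exp_pos _).le (by positivity)
    _ = D ^ 2 / 64 * (Real.exp (4 * δ) * Real.exp (-(δ / 2 * D))) := by ring
    _ ≤ (4 / (δ / 4) ^ 2 * Real.exp (δ / 4 * D)) / 64 * (Real.exp (4 * δ) * Real.exp (-(δ / 2 * D))) := by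
        gcongr
    _ = Real.exp (4 * δ) / δ ^ 2 * (Real.exp (δ / 4 * D) * Real.exp (-(δ / 2 * D))) := by
        field_simp
        ring
    _ = Real.exp (4 * δ) / δ ^ 2 * Real.exp (-(δ / 4 * D)) := by
        rw [← Real.exp_add]; congr 1; congr 1; ring

/-- **THE FAR-FIELD LETTER** (`d ≥ 3`): for a block `B(y)` at separation `D = |blk p − y|_∞ ≥ 8`,
`Σ_{q∈B(y)} |G′(p,q)| ≤ cFar(d,a)·e^{4δ_u}∕δ_u²·e^{−(δ_u∕4)D}` — `(n+1)^d` entries of size `cFar·k²·(n+1)^{−d}·e^{−4δ_u k}`, `k = ⌊D∕8⌋`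
(`PointColumnDecay.abs_Gk_far_le`). [folklore] -/
theorem sum_block_abs_Gk_le_far (hd : 3 ≤ d) (n : ℕ) {a : ℝ} (ha : 0 < a) (p y : X d) (hD : 8 ≤ dist (blk n p) y) :
    ∑ q ∈ B n y, |Gk n a p q|
      ≤ cFar d a * Real.exp (4 * deltaU d a) / deltaU d a ^ 2 * Real.exp (-(deltaU d a / 4 * dist (blk n p) y)) := by
  have hδ := deltaU_pos d ha
  obtain ⟨hk1, hk8, hksq⟩ := floor_sq_exp_le hδ hD
  set k : ℕ := ⌊dist (blk n p) y / 8⌋₊ with hk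
  have hs : (0 : ℝ) < (n : ℝ) + 1 := by positivity
  have hsd : (0 : ℝ) < ((n : ℝ) + 1) ^ d := pow_pos hs d
  have hpt : ∀ q ∈ B n y,
      |Gk n a p q| ≤ cFar d a * (k : ℝ) ^ 2 / ((n : ℝ) + 1) ^ d * Real.exp (-(4 * deltaU d a * k)) := by
    intro q hq
    have hy : blk n q = y := mem_B.1 hq
    exact abs_Gk_far_le hd n ha p q hk1 (by rw [hy]; exact hk8)
  calc ∑ q ∈ B n y, |Gk n a p q|
      ≤ ∑ q ∈ B n y, cFar d a * (k : ℝ) ^ 2 / ((n : ℝ) + 1) ^ d * Real.exp (-(4 * deltaU d a * k)) :=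
        Finset.sum_le_sum hpt
    _ = cFar d a * ((k : ℝ) ^ 2 * Real.exp (-(4 * deltaU d a * k))) := by
        rw [sum_B_const]; field_simp
    _ ≤ cFar d a * (Real.exp (4 * deltaU d a) / deltaU d a ^ 2 * Real.exp (-(deltaU d a / 4 * dist (blk n p) y))) :=
        mul_le_mul_of_nonneg_left hksq (cFar_pos d ha).le
    _ = _ := by ring

/-! ## §3. Every block, and the whole row: `‖G′‖_{ℓ^∞→ℓ^∞} ≤ A(d,a)·K_d(δ_u∕4)` uniformly in the mesh -/

/-- The row constant is non-negative. [folklore] -/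
theorem supConstG_nonneg (d : ℕ) {a : ℝ} (ha : 0 < a) :
    0 ≤ (cG0 d * cKL d (d - 2) + cSplit d a) * Real.exp (2 * deltaU d a)
        + cFar d a * Real.exp (4 * deltaU d a) / deltaU d a ^ 2 := by
  have := cG0_nonneg d; have := one_le_cKL d (d - 2); have := cSplit_nonneg d ha; have := cFar_pos d ha
  have := deltaU_pos d ha
  positivity

/-- **EVERY BLOCK** (`d ≥ 3`): `Σ_{q∈B(y)} |G′(p,q)| ≤ A(d,a)·e^{−(δ_u∕4)|blk p − y|_∞}` with
`A(d,a) = (cG0·cKL + cSplit)·e^{2δ_u} + cFar·e^{4δ_u}∕δ_u²` (near blocks by §1 and `e^{−(δ_u∕4)D} ≥ e^{−2δ_u}` for `D < 8`; far blocks by §2). [folklore] -/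
theorem sum_block_abs_Gk_le (hd : 3 ≤ d) (n : ℕ) {a : ℝ} (ha : 0 < a) (p y : X d) :
    ∑ q ∈ B n y, |Gk n a p q|
      ≤ ((cG0 d * cKL d (d - 2) + cSplit d a) * Real.exp (2 * deltaU d a)
          + cFar d a * Real.exp (4 * deltaU d a) / deltaU d a ^ 2)
        * Real.exp (-(deltaU d a / 4 * dist (blk n p) y)) := by
  have hδ := deltaU_pos d ha
  have hnear0 : 0 ≤ cG0 d * cKL d (d - 2) + cSplit d a := by
    have := cG0_nonneg d; have := one_le_cKL d (d - 2); have := cSplit_nonneg d ha; positivity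
  have hfar0 : 0 ≤ cFar d a * Real.exp (4 * deltaU d a) / deltaU d a ^ 2 := by
    have := cFar_pos d ha; positivity
  have hE : 0 < Real.exp (-(deltaU d a / 4 * dist (blk n p) y)) := Real.exp_pos _
  by_cases hD : 8 ≤ dist (blk n p) y
  · have h := sum_block_abs_Gk_le_far hd n ha p y hD
    have h2 : 0 ≤ (cG0 d * cKL d (d - 2) + cSplit d a) * Real.exp (2 * deltaU d a)
        * Real.exp (-(deltaU d a / 4 * dist (blk n p) y)) := by positivity
    nlinarith
  · rw [not_le] at hD
    have h := sum_block_abs_Gk_le_unif hd n ha p y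
    have hexp : 1 ≤ Real.exp (2 * deltaU d a) * Real.exp (-(deltaU d a / 4 * dist (blk n p) y)) := by
      rw [← Real.exp_add]; exact Real.one_le_exp (by nlinarith)
    have h1 : cG0 d * cKL d (d - 2) + cSplit d a
        ≤ (cG0 d * cKL d (d - 2) + cSplit d a) * Real.exp (2 * deltaU d a)
          * Real.exp (-(deltaU d a / 4 * dist (blk n p) y)) := by
      rw [mul_assoc]; exact le_mul_of_one_le_right hnear0 hexp
    have h2 : 0 ≤ cFar d a * Real.exp (4 * deltaU d a) / deltaU d a ^ 2
        * Real.exp (-(deltaU d a / 4 * dist (blk n p) y)) := by positivity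
    nlinarith

/-- The row `q ↦ |G′(p,q)|` is summable (every `d`; `B5Hk103ScalarZd.summable_Gk_row`). [folklore] -/
theorem summable_abs_Gk_row (n : ℕ) {a : ℝ} (ha : 0 < a) (p : X d) : Summable fun q : X d => |Gk n a p q| :=
  (summable_Gk_row n ha p).abs

/-- **`‖G′‖_{ℓ^∞ → ℓ^∞} ≤ A(d,a)·K_d(δ_u∕4)` UNIFORMLY IN THE MESH** (`d ≥ 3`): `Σ′_q |G′(p,q)| ≤ A(d,a)·K_d(δ_u∕4)` for every `p` and every
side `n + 1` — [B5] (1.115)'s kind of letter for the scalar `ℤ^d` block-averaged massive propagator, by proof. [folklore] -/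
theorem tsum_abs_Gk_le_sup (hd : 3 ≤ d) (n : ℕ) {a : ℝ} (ha : 0 < a) (p : X d) :
    ∑' q : X d, |Gk n a p q|
      ≤ ((cG0 d * cKL d (d - 2) + cSplit d a) * Real.exp (2 * deltaU d a)
          + cFar d a * Real.exp (4 * deltaU d a) / deltaU d a ^ 2) * latticeConst d (deltaU d a / 4) := by
  set A := (cG0 d * cKL d (d - 2) + cSplit d a) * Real.exp (2 * deltaU d a)
          + cFar d a * Real.exp (4 * deltaU d a) / deltaU d a ^ 2 with hA
  have hA0 : 0 ≤ A := supConstG_nonneg d ha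
  have hδ4 : 0 < deltaU d a / 4 := by have := deltaU_pos d ha; positivity
  have hmaj : Summable fun y : X d => A * Real.exp (-(deltaU d a / 4 * dist (blk n p) y)) :=
    (summable_expX hδ4 (blk n p)).mul_left A
  rw [← tsum_blocks n (summable_abs_Gk_row n ha p)]
  calc ∑' y : X d, ∑ q ∈ B n y, |Gk n a p q| ≤ ∑' y : X d, A * Real.exp (-(deltaU d a / 4 * dist (blk n p) y)) :=
        Summable.tsum_le_tsum (fun y => sum_block_abs_Gk_le hd n ha p y) (summable_blocks n (summable_abs_Gk_row n ha p)) hmaj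
    _ = A * ∑' y : X d, Real.exp (-(deltaU d a / 4 * dist (blk n p) y)) := tsum_mul_left
    _ ≤ A * latticeConst d (deltaU d a / 4) := mul_le_mul_of_nonneg_left (tsum_expX_le hδ4 (blk n p)) hA0

/-- **The floor**: `a⁻¹ ≤ A(d,a)·K_d(δ_u∕4)` (`d ≥ 3`), because `G′·1 = a⁻¹` (`B5Hk103ScalarZd.tsum_Gk_row`). [folklore] -/
theorem inv_a_le_supConstG (hd : 3 ≤ d) (n : ℕ) {a : ℝ} (ha : 0 < a) :
    1 / a ≤ ((cG0 d * cKL d (d - 2) + cSplit d a) * Real.exp (2 * deltaU d a)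
          + cFar d a * Real.exp (4 * deltaU d a) / deltaU d a ^ 2) * latticeConst d (deltaU d a / 4) := by
  have hs : Summable fun q : X d => ‖Gk n a (0 : X d) q‖ := by
    simpa only [Real.norm_eq_abs] using summable_abs_Gk_row n ha (0 : X d)
  have h2 := norm_tsum_le_tsum_norm hs
  simp only [Real.norm_eq_abs] at h2
  rw [tsum_Gk_row n ha, abs_of_pos (div_pos one_pos ha)] at h2
  exact h2.trans (tsum_abs_Gk_le_sup hd n ha 0)

/-! ## §4. `G′` on bounded data -/

/-- For bounded `f` (`|f| ≤ R`) the row series `Σ′_q G′(p,q)f(q)` converges absolutely (every `d`). [folklore] -/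
theorem summable_Gk_mul_of_bounded (n : ℕ) {a : ℝ} (ha : 0 < a) {f : X d → ℝ} {R : ℝ} (hf : ∀ q, |f q| ≤ R) (p : X d) :
    Summable fun q : X d => Gk n a p q * f q := by
  refine Summable.of_norm_bounded ((summable_abs_Gk_row n ha p).mul_right R) fun q => ?_
  rw [Real.norm_eq_abs, abs_mul]
  exact mul_le_mul_of_nonneg_left (hf q) (abs_nonneg _)

/-- **THE SUP LETTER FOR `G′`** (`d ≥ 3`): `|Σ′_q G′(p,q)f(q)| ≤ A(d,a)·K_d(δ_u∕4)·R` for every `p`, every side and every `|f| ≤ R`. [folklore] -/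
theorem abs_tsum_Gk_mul_le_sup (hd : 3 ≤ d) (n : ℕ) {a : ℝ} (ha : 0 < a) {f : X d → ℝ} {R : ℝ} (hf : ∀ q, |f q| ≤ R)
    (p : X d) :
    |∑' q : X d, Gk n a p q * f q|
      ≤ ((cG0 d * cKL d (d - 2) + cSplit d a) * Real.exp (2 * deltaU d a)
          + cFar d a * Real.exp (4 * deltaU d a) / deltaU d a ^ 2) * latticeConst d (deltaU d a / 4) * R := by
  have hR : 0 ≤ R := (abs_nonneg _).trans (hf 0)
  have hsum : HasSum (fun q : X d => |Gk n a p q| * R) ((∑' q : X d, |Gk n a p q|) * R) :=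
    (summable_abs_Gk_row n ha p).hasSum.mul_right R
  have h := tsum_of_norm_bounded hsum fun q => by
    rw [Real.norm_eq_abs, abs_mul]
    exact mul_le_mul_of_nonneg_left (hf q) (abs_nonneg _)
  rw [Real.norm_eq_abs] at h
  exact h.trans (mul_le_mul_of_nonneg_right (tsum_abs_Gk_le_sup hd n ha p) hR)

/-! ## §5. Toy -/

/-- Toy: the `⌊D∕8⌋` arithmetic at `D = 16`, `δ = 1`: `k = 2`, `8k ≤ 16`, and `4·e^{−8} ≤ e^{4}·e^{−4}` (= 1). -/
example : 1 ≤ ⌊(16 : ℝ) / 8⌋₊ ∧ 8 * (⌊(16 : ℝ) / 8⌋₊ : ℝ) ≤ 16 ∧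
    (⌊(16 : ℝ) / 8⌋₊ : ℝ) ^ 2 * Real.exp (-(4 * 1 * ⌊(16 : ℝ) / 8⌋₊)) ≤ Real.exp (4 * 1) / 1 ^ 2 * Real.exp (-(1 / 4 * 16)) :=
  floor_sq_exp_le one_pos (by norm_num)

end

end Summit.QuantumFields.BalabanUV.T4Continuum.NE7b.BlockPropagatorSupNorm
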